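import Mathlib
import HarnessLib
import Summits.HubbardSuperconductivity.HubbardSuperconductivity.Theorems.KLProgrammeKLRegimeTwoVolumeGluedSourcePair

/-!
# Route `KLProgramme` — crux K3, VL child (stmt-HubbardSuperconductivity-20440): NEAR ≤ GLUED + FAR ROWS FOR ARBITRARY PINNED PAIR FUNCTIONS
# (cell gate-hubbard-kl, seat hubbard-kl-k3c4-p1 g17; the function-level form of k3c5-p3's `…TwoVolumeGluedSourcePair.twoEps_near_le_glued_add_far`,
# used by the window-keyed END chain «(VL)-SRC-WINDOW» (β), door (g)W of `…VolumeLimitV12EndDoorsWB`)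

k3c5-p3's `twoEps_near_le_glued_add_far` / `twoEps_near_le_gluedSrc_add_far` bound the NEAR same-offset pinned two-volume defect by the GLUED pinned defect
plus the far rows, for the specific source-pair kernels of `srcTrunc 3 (klSrcAction …)`, the far rows being paid by token #24's `klSrcPinnedSum`.  Under the
window key the END chain's position-space currency is a DIFFERENT pair function (the window-dressed two-leg kernel `W^χ`), so this file proves the same
inequality ONCE for arbitrary pinned pair functions `W_c : (Fin 2 → SpaceTimeIdx L M) → ℂ`, `W_f : (Fin 2 → SpaceTimeIdx L″ M) → ℂ` (`L″ = b·L`), with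
the `ε`-weighted rows of both volumes as the far-row budget (the convention of `…VolumeLimitLastScaleFarRows.twoEps_sum_far_le_of_weightedRows`):

`twoEps_near_le_gluedPos_add_far` — for an `R`-deep fine pin `o_f`, coarse pin `o_c := (t_f, red o⃗_f)`, `ε, Λ ≥ 0`,
`ε·Σ_{t₁,ȳ}(1 + Λ‖ȳ‖_𝕋)‖W_c(o_c,(t₁,o⃗_c+ȳ))‖ ≤ B_c` and `ε·Σ_{t₁,y}(1 + Λ‖y‖_𝕋)‖W_f(o_f,(t₁,o⃗_f+y))‖ ≤ B_f`:
`2ε·Σ_{t₁,ȳ}‖W_c(o_c,(t₁,o⃗_c+ȳ)) − W_f(o_f,(t₁,o⃗_f+ȳ↑))‖ ≤ 2ε·Σ_{t₁,y}‖W_f(o_f,(t₁,y)) − [y ∼ o⃗_f]·W_c(o_c,(t₁,red y))‖ + 2(B_c + B_f)/(1 + ΛR)`,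
where `y ∼ o⃗_f` means «same blocks» (`y_j / L = (o⃗_f)_j / L` for all `j`) and `ȳ↑ = proj (cRep ȳ)` is the centred lift.  Near offsets (`|cRep ȳ_i| < R`)
of a deep pin stay in its blocks (`block_eq_of_deep_of_natAbs_lt`) and reduce to `red o⃗_f + ȳ` (`reduce_add_clift`), so they ARE glued strings; the other
offsets are far in both volumes (`le_tnorm_of_not_near`, `tnorm_le_tnorm_clift`) and are paid by the weights (`sum_filter_le_inv_mul_weighted`).

Proof only (k3c5-p3's argument with the model kernels replaced by function arguments); no definition; nothing asserts any stub, K3, VL or superconductivity.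
[cite: BenfattoGiulianiMastropietro2006, §2.4 (2.38)]
-/

noncomputable section

namespace Summit.HubbardSuperconductivity.HubbardSuperconductivity.Theorems.TwoVolumeDefect

set_option linter.dupNamespace false -- summit = problem name (single-conjunct summit), D-0017

open Finset Literature.MathematicalPhysics.QuantumLattice Literature.Probability.LatticeModels
open Summit.HubbardSuperconductivity.HubbardSuperconductivity.Theorems.TwoVolumeSource (sum_filter_le_inv_mul_weighted)

section NearGluedPos

variable {b L Lf M : ℕ} [NeZero Lf] [NeZero L]

/-- **`2ε·NEAR ≤ 2ε·GLUED_pos + 2(B_c + B_f)/(1 + ΛR)` for arbitrary pinned pair functions** (see the module docstring): `L″ = b·L`, an `R`-deep fine pin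
`o_f`, the coarse pin `(t_f, red o⃗_f)`, `ε, Λ ≥ 0`, and the `ε`-weighted rows of both volumes bounded by `B_c`, `B_f`.
[cite: BenfattoGiulianiMastropietro2006, §2.4 (2.38)] -/
theorem twoEps_near_le_gluedPos_add_far (hLf : Lf = b * L) (Wc : (Fin 2 → SpaceTimeIdx L M) → ℂ) (Wf : (Fin 2 → SpaceTimeIdx Lf M) → ℂ)
    (of : SpaceTimeIdx Lf M) {R : ℕ} (hof : ∀ j, R ≤ (of.2 j).val % L ∧ (of.2 j).val % L + R < L) {ε Λ Bc Bf : ℝ} (hε : 0 ≤ ε) (hΛ : 0 ≤ Λ)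
    (hBc : ε * ∑ t₁ : ImagTimeIdx M, ∑ ybar : TorusSite 2 L, (1 + Λ * (Torus.tnorm ybar : ℝ)) *
      ‖Wc ![(of.1, fun i => (((of.2 i).val : ℕ) : ZMod L)), (t₁, (fun i => (((of.2 i).val : ℕ) : ZMod L)) + ybar)]‖ ≤ Bc)
    (hBf : ε * ∑ t₁ : ImagTimeIdx M, ∑ y : TorusSite 2 Lf, (1 + Λ * (Torus.tnorm y : ℝ)) * ‖Wf ![of, (t₁, of.2 + y)]‖ ≤ Bf) :
    2 * ε * (∑ t₁ : ImagTimeIdx M, ∑ ybar : TorusSite 2 L,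
        ‖Wc ![(of.1, fun i => (((of.2 i).val : ℕ) : ZMod L)), (t₁, (fun i => (((of.2 i).val : ℕ) : ZMod L)) + ybar)] -
          Wf ![of, (t₁, of.2 + Torus.proj Lf (Torus.cRep ybar))]‖) ≤
      2 * ε * (∑ t₁ : ImagTimeIdx M, ∑ y : TorusSite 2 Lf,
        ‖Wf ![of, (t₁, y)] - (if ∀ j, (y j).val / L = (of.2 j).val / L then
            Wc ![(of.1, fun i => (((of.2 i).val : ℕ) : ZMod L)), (t₁, fun i => (((y i).val : ℕ) : ZMod L))] else 0)‖) +
      2 * (Bc + Bf) / (1 + Λ * R) := by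
  classical
  -- names
  set ocs : TorusSite 2 L := fun i => (((of.2 i).val : ℕ) : ZMod L) with hocs
  let a : ImagTimeIdx M → TorusSite 2 L → ℂ := fun t₁ ybar => Wc ![(of.1, ocs), (t₁, ocs + ybar)]
  let f : ImagTimeIdx M → TorusSite 2 L → ℂ := fun t₁ ybar => Wf ![of, (t₁, of.2 + Torus.proj Lf (Torus.cRep ybar))]
  let G : ImagTimeIdx M → TorusSite 2 Lf → ℝ := fun t₁ y =>
    ‖Wf ![of, (t₁, y)] - (if ∀ j, (y j).val / L = (of.2 j).val / L then Wc ![(of.1, ocs), (t₁, fun i => (((y i).val : ℕ) : ZMod L))] else 0)‖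
  let Pn : TorusSite 2 L → Prop := fun ybar => ∀ i, (Torus.cRepZ (ybar i)).natAbs < R
  haveI hPnDec : DecidablePred Pn := fun ybar => by dsimp only [Pn]; infer_instance
  show 2 * ε * (∑ t₁, ∑ ybar, ‖a t₁ ybar - f t₁ ybar‖) ≤ 2 * ε * (∑ t₁, ∑ y, G t₁ y) + 2 * (Bc + Bf) / (1 + Λ * R)
  -- (A) near offsets ARE glued strings at the pin
  have hnear : ∀ (t₁ : ImagTimeIdx M) (ybar : TorusSite 2 L), Pn ybar →
      ‖a t₁ ybar - f t₁ ybar‖ = G t₁ (of.2 + Torus.proj Lf (Torus.cRep ybar)) := by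
    intro t₁ ybar hy
    have hblk : ∀ j, ((of.2 + Torus.proj Lf (Torus.cRep ybar)) j).val / L = (of.2 j).val / L :=
      block_eq_of_deep_of_natAbs_lt hLf of.2 hof ybar hy
    have hres : (fun i => ((((of.2 + Torus.proj Lf (Torus.cRep ybar)) i).val : ℕ) : ZMod L)) = ocs + ybar := reduce_add_clift hLf of.2 ybar
    show ‖a t₁ ybar - f t₁ ybar‖ = ‖Wf ![of, (t₁, of.2 + Torus.proj Lf (Torus.cRep ybar))] - _‖
    rw [if_pos hblk, hres, norm_sub_rev]
  -- (B) the near part ≤ the glued pinned defect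
  have hG0 : ∀ t₁ y, 0 ≤ G t₁ y := fun _ _ => norm_nonneg _
  have hinj : Function.Injective (fun ybar : TorusSite 2 L => of.2 + Torus.proj Lf (Torus.cRep ybar)) :=
    fun y y' h => clift_injective hLf (add_left_cancel h)
  have hB : ∀ t₁ : ImagTimeIdx M, ∑ ybar ∈ univ.filter Pn, ‖a t₁ ybar - f t₁ ybar‖ ≤ ∑ y, G t₁ y := by
    intro t₁
    calc ∑ ybar ∈ univ.filter Pn, ‖a t₁ ybar - f t₁ ybar‖
        = ∑ ybar ∈ univ.filter Pn, G t₁ (of.2 + Torus.proj Lf (Torus.cRep ybar)) :=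
          sum_congr rfl fun ybar hy => hnear t₁ ybar (mem_filter.1 hy).2
      _ ≤ ∑ ybar, G t₁ (of.2 + Torus.proj Lf (Torus.cRep ybar)) :=
          sum_le_sum_of_subset_of_nonneg (filter_subset _ _) fun ybar _ _ => hG0 _ _
      _ = ∑ y ∈ (univ : Finset (TorusSite 2 L)).image (fun ybar => of.2 + Torus.proj Lf (Torus.cRep ybar)), G t₁ y :=
          (sum_image fun y _ y' _ h => hinj h).symm
      _ ≤ ∑ y, G t₁ y := sum_le_sum_of_subset_of_nonneg (subset_univ _) fun y _ _ => hG0 _ _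
  -- (C) the far part ≤ far rows of both volumes
  have hfar_y : ∀ ybar ∈ (univ : Finset (TorusSite 2 L)), ¬ Pn ybar → R ≤ Torus.tnorm ybar := fun ybar _ h => le_tnorm_of_not_near h
  have hfar_y' : ∀ ybar ∈ (univ : Finset (TorusSite 2 L)), ¬ Pn ybar → R ≤ Torus.tnorm (Torus.proj Lf (Torus.cRep ybar)) :=
    fun ybar _ h => (le_tnorm_of_not_near h).trans (tnorm_le_tnorm_clift hLf ybar)
  have hC1 : ∀ t₁ : ImagTimeIdx M, ∑ ybar ∈ univ.filter (fun y => ¬ Pn y), ‖a t₁ ybar‖ ≤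
      (1 + Λ * R)⁻¹ * ∑ ybar, (1 + Λ * (Torus.tnorm ybar : ℝ)) * ‖a t₁ ybar‖ := fun t₁ =>
    sum_filter_le_inv_mul_weighted univ Pn (fun y => ‖a t₁ y‖) (fun y => Torus.tnorm y) (fun _ _ => norm_nonneg _) hΛ hfar_y
  have hC2 : ∀ t₁ : ImagTimeIdx M, ∑ ybar ∈ univ.filter (fun y => ¬ Pn y), ‖f t₁ ybar‖ ≤
      (1 + Λ * R)⁻¹ * ∑ y' : TorusSite 2 Lf, (1 + Λ * (Torus.tnorm y' : ℝ)) * ‖Wf ![of, (t₁, of.2 + y')]‖ := by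
    intro t₁
    refine (sum_filter_le_inv_mul_weighted univ Pn (fun y => ‖f t₁ y‖) (fun y => Torus.tnorm (Torus.proj Lf (Torus.cRep y)))
      (fun _ _ => norm_nonneg _) hΛ hfar_y').trans ?_
    refine mul_le_mul_of_nonneg_left ?_ (by positivity)
    -- reindex by the injective centred lift and drop the other fine offsets
    let g : TorusSite 2 Lf → ℝ := fun y' => (1 + Λ * (Torus.tnorm y' : ℝ)) * ‖Wf ![of, (t₁, of.2 + y')]‖
    have hg0 : ∀ y', 0 ≤ g y' := fun y' => by positivity
    calc ∑ y, (1 + Λ * (Torus.tnorm (Torus.proj Lf (Torus.cRep y)) : ℝ)) * ‖f t₁ y‖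
        = ∑ y, g (Torus.proj Lf (Torus.cRep y)) := rfl
      _ = ∑ y' ∈ (univ : Finset (TorusSite 2 L)).image (fun y => Torus.proj Lf (Torus.cRep y)), g y' :=
          (sum_image fun y _ y' _ h => clift_injective hLf h).symm
      _ ≤ ∑ y', g y' := sum_le_sum_of_subset_of_nonneg (subset_univ _) fun y' _ _ => hg0 y'
  -- assemble
  have hsplit : ∀ t₁ : ImagTimeIdx M, ∑ ybar, ‖a t₁ ybar - f t₁ ybar‖ =
      (∑ ybar ∈ univ.filter Pn, ‖a t₁ ybar - f t₁ ybar‖) + ∑ ybar ∈ univ.filter (fun y => ¬ Pn y), ‖a t₁ ybar - f t₁ ybar‖ :=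
    fun t₁ => (sum_filter_add_sum_filter_not _ _ _).symm
  have hfar : ∀ t₁ : ImagTimeIdx M, ∑ ybar ∈ univ.filter (fun y => ¬ Pn y), ‖a t₁ ybar - f t₁ ybar‖ ≤
      (1 + Λ * R)⁻¹ * ∑ ybar, (1 + Λ * (Torus.tnorm ybar : ℝ)) * ‖a t₁ ybar‖ +
        (1 + Λ * R)⁻¹ * ∑ y' : TorusSite 2 Lf, (1 + Λ * (Torus.tnorm y' : ℝ)) * ‖Wf ![of, (t₁, of.2 + y')]‖ := by
    intro t₁
    refine le_trans (sum_le_sum fun ybar _ => norm_sub_le (a t₁ ybar) (f t₁ ybar)) ?_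
    rw [sum_add_distrib]
    exact add_le_add (hC1 t₁) (hC2 t₁)
  have hR1 : (0 : ℝ) < 1 + Λ * R := by positivity
  calc 2 * ε * ∑ t₁, ∑ ybar, ‖a t₁ ybar - f t₁ ybar‖
      = 2 * ε * ∑ t₁, ((∑ ybar ∈ univ.filter Pn, ‖a t₁ ybar - f t₁ ybar‖) +
          ∑ ybar ∈ univ.filter (fun y => ¬ Pn y), ‖a t₁ ybar - f t₁ ybar‖) := by simp_rw [← hsplit]
    _ = 2 * ε * (∑ t₁, ∑ ybar ∈ univ.filter Pn, ‖a t₁ ybar - f t₁ ybar‖) +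
          2 * ε * ∑ t₁, ∑ ybar ∈ univ.filter (fun y => ¬ Pn y), ‖a t₁ ybar - f t₁ ybar‖ := by rw [sum_add_distrib, mul_add]
    _ ≤ 2 * ε * (∑ t₁, ∑ y, G t₁ y) +
          2 * ε * ∑ t₁, ((1 + Λ * R)⁻¹ * ∑ ybar, (1 + Λ * (Torus.tnorm ybar : ℝ)) * ‖a t₁ ybar‖ +
            (1 + Λ * R)⁻¹ * ∑ y' : TorusSite 2 Lf, (1 + Λ * (Torus.tnorm y' : ℝ)) * ‖Wf ![of, (t₁, of.2 + y')]‖) := by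
        have h2ε : 0 ≤ 2 * ε := by positivity
        exact add_le_add (mul_le_mul_of_nonneg_left (sum_le_sum fun t₁ _ => hB t₁) h2ε)
          (mul_le_mul_of_nonneg_left (sum_le_sum fun t₁ _ => hfar t₁) h2ε)
    _ = 2 * ε * (∑ t₁, ∑ y, G t₁ y) +
          2 * (1 + Λ * R)⁻¹ * (ε * ∑ t₁, ∑ ybar, (1 + Λ * (Torus.tnorm ybar : ℝ)) * ‖a t₁ ybar‖ +
            ε * ∑ t₁, ∑ y' : TorusSite 2 Lf, (1 + Λ * (Torus.tnorm y' : ℝ)) * ‖Wf ![of, (t₁, of.2 + y')]‖) := by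
        rw [sum_add_distrib, ← mul_sum, ← mul_sum]; ring
    _ ≤ 2 * ε * (∑ t₁, ∑ y, G t₁ y) + 2 * (1 + Λ * R)⁻¹ * (Bc + Bf) := by
        have h2R : 0 ≤ 2 * (1 + Λ * R)⁻¹ := by positivity
        exact add_le_add le_rfl (mul_le_mul_of_nonneg_left (add_le_add hBc hBf) h2R)
    _ = _ := by rw [div_eq_mul_inv]; ring

end NearGluedPos

end Summit.HubbardSuperconductivity.HubbardSuperconductivity.Theorems.TwoVolumeDefect

end
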